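import Summits.ResolutionOfSingularities.ResolutionOfSingularities.Theorems.MarkedTransferCampaignW46ThreefoldsGammaFreeGlobalSNCFinite
import HarnessLib

/-!
# [OURS · L1 W4.6 rung (ii), dimension ladder] `SNCAt` AT A POINT OF A REGULAR SURFACE, READ ON A FAMILY OF PRIME DIVISORS:
# the two-branch criterion and the trichotomy of non-snc points (brick B10b-snc of rung (ii-2) `GammaFreeGlobalOrderReductionDimLE p 2`)

Cell res-hironaka, LADDER-RESOLUTION rung L (D-0089), slot W4.6, rung (ii) (dimension ladder, res-L1-type-o1 p496755); seat
res-D-pv-049 AS res-L1-s46-pv-11 (holder of rung (ii-2); architecture v2, STATUS 2026-08-27T05:4xZ). Host route MarkedTransfer,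
host item `HypersurfaceOrderReductionDimLeThree` (stmt-ResolutionOfSingularities-16156); proposed `--kind proof --supports` it
`--as helper`. Everything here is OURS local algebra of a two-dimensional regular local ring; nothing of H. Hironaka's
manuscript [Hironaka2017] is asserted. AI-written; AI review is weaker than expert review.

## What is proved

* `sncAt_of_span_pair` — **two transversal regular branches are snc**: if `𝒪_{X,y}` is regular with `𝔪_y = (p, q)` minimally
  (`spanFinrank 𝔪_y = 2`) and every member of `L` through `y` has stalk `(p)` or `(q)`, members with equal stalks being
  equal, then `SNCAt L y` (complements res-D-pv-039's `sncAt_of_forall_not_mem_support` / `sncAt_of_stalkIdeal_eq_span_singleton`).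
* `sncAt_of_family` — for `L` the list of prime-divisor ideals of an injective family `ζ` of codimension-one points on a
  regular `X`, at a point `y` with `dim 𝒪_{X,y} = 2`: if every branch through `y` is regular (`𝒪_{X,y}/𝔭_{ζ_k}` regular),
  every two branches through `y` are transversal (`𝔭_{ζ_k} + 𝔭_{ζ_l} = 𝔪_y`) and at most two branches pass through `y`,
  then `SNCAt L y`.
* `not_sncAt_trichotomy` — contrapositive: a NON-snc point `y` carries a singular branch, or (all branches regular and) a
  tangent pair, or (all regular, pairwise transversal and) at least three branches — the case distinction driving the
  lexicographic measure `(Δ, Σ(i−1), Σ(k−2)⁺)` of the `d = 2` loop (Hartshorne V Thm. 3.9).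

## Sources

* R. Hartshorne, *Algebraic Geometry* (1977), Ch. V Thm. 3.9, Rem. 3.5.2. [Hartshorne1977]
* H. Matsumura, *Commutative Ring Theory* (1986), Thms. 14.2, 20.3. [Matsumura1987]
* H. Hironaka, ms. 2017-03-23, Def. 2.1 p.5 — scope only, under adjudication, not cited as fact. [Hironaka2017]
-/

noncomputable section

set_option linter.dupNamespace false -- mandated namespace of this single-conjunct summit

open CategoryTheory AlgebraicGeometry TopologicalSpace IsLocalRing Topology

namespace Summit.ResolutionOfSingularities.ResolutionOfSingularities.Theorems

namespace CampaignW46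

open Literature.AlgebraicGeometry.Resolution
open Scheme.IdealSheafData

universe u

variable {X : Scheme.{u}}

/-! ## Two transversal regular branches -/

/-- **Two transversal regular branches are snc.** `𝒪_{X,y}` regular with `𝔪_y = (p, q)` and `spanFinrank 𝔪_y = 2`;
every member of `L` through `y` has stalk `(p)` or `(q)` at `y`, and members of `L` through `y` with the same stalk are
equal. Then `SNCAt L y`, with the regular system of parameters `(p, q)`. [cite: Matsumura1987, Thm. 14.2] -/
theorem sncAt_of_span_pair (L : List X.IdealSheafData) {y : X} (hreg : IsRegularLocalRing (X.presheaf.stalk y))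
    (h2 : (maximalIdeal (X.presheaf.stalk y)).spanFinrank = 2) {p q : X.presheaf.stalk y}
    (hm : maximalIdeal (X.presheaf.stalk y) = Ideal.span {p, q})
    (hmem : ∀ D : {D : X.IdealSheafData // D ∈ L ∧ y ∈ D.support},
      stalkIdeal D.1 y = Ideal.span {p} ∨ stalkIdeal D.1 y = Ideal.span {q})
    (hinj : ∀ D₁ D₂ : {D : X.IdealSheafData // D ∈ L ∧ y ∈ D.support}, stalkIdeal D₁.1 y = stalkIdeal D₂.1 y → D₁ = D₂) :
    SNCAt L y := by
  classical
  -- `(p) ≠ (q)`: otherwise `𝔪 = (p)` would be generated by one element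
  have hpq : Ideal.span ({p} : Set (X.presheaf.stalk y)) ≠ Ideal.span {q} := by
    intro h
    have hmp : maximalIdeal (X.presheaf.stalk y) = Ideal.span {p} := by
      rw [hm, Ideal.span_insert, ← h, sup_idem]
    by_cases hp0 : p = 0
    · have : (maximalIdeal (X.presheaf.stalk y)).spanFinrank = 0 := by
        rw [hmp, hp0, Ideal.span_singleton_eq_bot.mpr rfl]
        exact Submodule.spanFinrank_bot
      omega
    · have : (maximalIdeal (X.presheaf.stalk y)).spanFinrank = 1 := by
        rw [hmp]
        exact Submodule.spanFinrank_singleton hp0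
      omega
  let σ : Fin (maximalIdeal (X.presheaf.stalk y)).spanFinrank ≃ Fin 2 := finCongr h2
  let u : Fin (maximalIdeal (X.presheaf.stalk y)).spanFinrank → X.presheaf.stalk y :=
    fun i => if σ i = 0 then p else q
  have hu0 : u (σ.symm 0) = p := by simp [u]
  have hu1 : u (σ.symm 1) = q := by
    simp only [u, Equiv.apply_symm_apply]
    rw [if_neg (by decide)]
  have hrange : Set.range u = {p, q} := by
    ext a
    constructor
    · rintro ⟨i, rfl⟩
      by_cases hi : σ i = 0
      · simp [u, hi]
      · simp [u, hi]
    · rintro (rfl | rfl)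
      · exact ⟨σ.symm 0, hu0⟩
      · exact ⟨σ.symm 1, hu1⟩
  let ι : {D : X.IdealSheafData // D ∈ L ∧ y ∈ D.support} → Fin (maximalIdeal (X.presheaf.stalk y)).spanFinrank :=
    fun D => if stalkIdeal D.1 y = Ideal.span {p} then σ.symm 0 else σ.symm 1
  refine ⟨hreg, u, by rw [hrange, hm], ι, ?_, ?_⟩
  · intro D₁ D₂ h
    by_cases h₁ : stalkIdeal D₁.1 y = Ideal.span {p} <;> by_cases h₂ : stalkIdeal D₂.1 y = Ideal.span {p}
    · exact hinj D₁ D₂ (h₁.trans h₂.symm)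
    · exfalso
      have : σ.symm 0 = σ.symm 1 := by simp only [ι, h₁, h₂, ↓reduceIte] at h; exact h
      exact absurd (σ.symm.injective this) (by decide)
    · exfalso
      have : σ.symm 1 = σ.symm 0 := by simp only [ι, h₁, h₂, ↓reduceIte] at h; exact h
      exact absurd (σ.symm.injective this) (by decide)
    · have e₁ := (hmem D₁).resolve_left h₁
      have e₂ := (hmem D₂).resolve_left h₂
      exact hinj D₁ D₂ (e₁.trans e₂.symm)
  · intro D
    by_cases h₁ : stalkIdeal D.1 y = Ideal.span {p}
    · simp only [ι, h₁, if_true, hu0]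
    · simp only [ι, h₁, if_false, hu1]
      exact (hmem D).resolve_left h₁

/-! ## `SNCAt` read on a family of prime divisors -/

section Family

variable [IsIntegral X] {ι : Type} [Finite ι]

omit [IsIntegral X] in
/-- A codimension-one point is not a point whose local ring has dimension two. [folklore] -/
theorem ne_of_coheight_eq_one_of_ringKrullDim_eq_two {ζ y : X} (hζ : Order.coheight ζ = 1)
    (hdim : ringKrullDim (X.presheaf.stalk y) = 2) : ζ ≠ y := by
  rintro rfl
  rw [ringKrullDim_stalk_eq_coheight, hζ] at hdim
  exact absurd hdim (by decide)

/-- **`SNCAt` at a point of a regular surface, read on a family of prime divisors.** `X` regular and integral; `ζ` an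
finite family of codimension-one points and `L` the list of their prime-divisor ideal sheaves (up to order and
repetition); `y` a point with `dim 𝒪_{X,y} = 2`. If every branch through `y` is regular at `y`, every two branches through
`y` are transversal, and at most two branches pass through `y`, then `SNCAt L y`. [cite: Hartshorne1977, Ch. V Rem. 3.5.2] -/
theorem sncAt_of_family (hX : Scheme.IsRegular X) (L : List X.IdealSheafData) (ζ : ι → X)
    (hL : ∀ D, D ∈ L ↔ ∃ k, primeDivisorIdeal (ζ k) = D)
    (hcoh : ∀ k, Order.coheight (ζ k) = 1) {y : X} (hdim : ringKrullDim (X.presheaf.stalk y) = 2)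
    (hbr : ∀ k, ζ k ⤳ y → IsRegularLocalRing (X.presheaf.stalk y ⧸ stalkIdeal (primeDivisorIdeal (ζ k)) y))
    (htr : ∀ k l, k ≠ l → ζ k ⤳ y → ζ l ⤳ y →
      stalkIdeal (primeDivisorIdeal (ζ k)) y ⊔ stalkIdeal (primeDivisorIdeal (ζ l)) y = maximalIdeal (X.presheaf.stalk y))
    (hcount : Nat.card {k : ι // ζ k ⤳ y ∧ ζ k ≠ y} ≤ 2) : SNCAt L y := by
  classical
  haveI : IsRegularLocalRing (X.presheaf.stalk y) := hX y
  have hUFD := Scheme.IsRegular.uniqueFactorizationMonoid_stalk hX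
  have hne : ∀ k, ζ k ≠ y := fun k => ne_of_coheight_eq_one_of_ringKrullDim_eq_two (hcoh k) hdim
  -- members of `L` through `y` come from branches through `y`
  have hmemL : ∀ D : {D : X.IdealSheafData // D ∈ L ∧ y ∈ D.support},
      ∃ k, ζ k ⤳ y ∧ primeDivisorIdeal (ζ k) = D.1 := by
    rintro ⟨D, hD, hyD⟩
    obtain ⟨k, rfl⟩ := (hL D).mp hD
    exact ⟨k, (mem_support_primeDivisorIdeal_iff (ζ k) y).mp hyD, rfl⟩
  set B := {k : ι // ζ k ⤳ y ∧ ζ k ≠ y} with hB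
  have h2 : (maximalIdeal (X.presheaf.stalk y)).spanFinrank = 2 := by
    have h := IsRegularLocalRing.spanFinrank_maximalIdeal (R := X.presheaf.stalk y)
    rw [hdim] at h
    exact_mod_cast h
  -- case analysis on the number of branches through `y`
  rcases Nat.lt_or_ge (Nat.card B) 1 with h0 | h1
  · -- no branch through `y`
    have hemp : IsEmpty B := by
      rcases Nat.card_eq_zero.mp (Nat.lt_one_iff.mp h0) with h | h
      · exact h
      · exact absurd h (not_infinite_iff_finite.mpr inferInstance)
    refine sncAt_of_forall_not_mem_support L (hX y) fun D hD hyD => ?_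
    obtain ⟨k, hk, -⟩ := hmemL ⟨D, hD, hyD⟩
    exact hemp.false ⟨k, hk, hne k⟩
  rcases Nat.lt_or_ge (Nat.card B) 2 with hlt2 | hge2
  · -- exactly one branch `k₀` through `y`
    have hcard : Nat.card B = 1 := by omega
    obtain ⟨b₀, huniq⟩ := Nat.card_eq_one_iff_exists.mp hcard
    have hk₀ : ζ b₀.1 ⤳ y := b₀.2.1
    have hk : ∀ k, ζ k ⤳ y → k = b₀.1 := fun k hk =>
      congrArg Subtype.val (huniq ⟨k, hk, hne k⟩)
    obtain ⟨p, hp, hpeq⟩ := exists_stalkIdeal_primeDivisorIdeal_eq_span hUFD hk₀ (hcoh b₀.1)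
    have hquot : IsRegularLocalRing (X.presheaf.stalk y ⧸ Ideal.span {p}) := hpeq ▸ hbr b₀.1 hk₀
    refine sncAt_of_stalkIdeal_eq_span_singleton L (hX y) ((mem_maximalIdeal _).mpr hp.not_unit) hp.ne_zero hquot ?_ ?_
    · intro D₁ D₂
      obtain ⟨k₁, hk₁, e₁⟩ := hmemL D₁
      obtain ⟨k₂, hk₂, e₂⟩ := hmemL D₂
      apply Subtype.ext
      rw [← e₁, ← e₂, hk k₁ hk₁, hk k₂ hk₂]
    · intro D
      obtain ⟨k₁, hk₁, e₁⟩ := hmemL D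
      rw [← e₁, hk k₁ hk₁, hpeq]
  · -- exactly two branches `k₁ ≠ k₂` through `y`
    have hcard : Nat.card B = 2 := le_antisymm hcount hge2
    obtain ⟨b₁, b₂, hne12, huniv⟩ := Nat.card_eq_two_iff.mp hcard
    have hk₁ : ζ b₁.1 ⤳ y := b₁.2.1
    have hk₂ : ζ b₂.1 ⤳ y := b₂.2.1
    have hk12 : b₁.1 ≠ b₂.1 := fun h => hne12 (Subtype.ext h)
    have hk : ∀ k, ζ k ⤳ y → k = b₁.1 ∨ k = b₂.1 := by
      intro k hk
      have hmem : (⟨k, hk, hne k⟩ : B) ∈ ({b₁, b₂} : Set B) := by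
        rw [huniv]; exact Set.mem_univ _
      rcases hmem with h | h
      · exact Or.inl (congrArg Subtype.val h)
      · exact Or.inr (congrArg Subtype.val (Set.mem_singleton_iff.mp h))
    obtain ⟨p, hp, hpeq⟩ := exists_stalkIdeal_primeDivisorIdeal_eq_span hUFD hk₁ (hcoh b₁.1)
    obtain ⟨q, hq, hqeq⟩ := exists_stalkIdeal_primeDivisorIdeal_eq_span hUFD hk₂ (hcoh b₂.1)
    have hm : maximalIdeal (X.presheaf.stalk y) = Ideal.span {p, q} := by
      rw [← htr b₁.1 b₂.1 hk12 hk₁ hk₂, hpeq, hqeq, Ideal.span_insert]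
    have hpq : Ideal.span ({p} : Set (X.presheaf.stalk y)) ≠ Ideal.span {q} := by
      intro h
      have hmp : maximalIdeal (X.presheaf.stalk y) = Ideal.span {p} := by
        rw [hm, Ideal.span_insert, ← h, sup_idem]
      have : (maximalIdeal (X.presheaf.stalk y)).spanFinrank = 1 := by
        rw [hmp]; exact Submodule.spanFinrank_singleton hp.ne_zero
      omega
    refine sncAt_of_span_pair L (hX y) h2 hm ?_ ?_
    · intro D
      obtain ⟨k, hk', e⟩ := hmemL D
      rcases hk k hk' with rfl | rfl
      · exact Or.inl (e ▸ hpeq)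
      · exact Or.inr (e ▸ hqeq)
    · intro D₁ D₂ h
      obtain ⟨l₁, hl₁, e₁⟩ := hmemL D₁
      obtain ⟨l₂, hl₂, e₂⟩ := hmemL D₂
      apply Subtype.ext
      rw [← e₁, ← e₂]
      rw [← e₁, ← e₂] at h
      rcases hk l₁ hl₁ with rfl | rfl <;> rcases hk l₂ hl₂ with rfl | rfl
      · rfl
      · exact absurd (hpeq.symm.trans (h.trans hqeq)) hpq
      · exact absurd (hpeq.symm.trans (h.symm.trans hqeq)) hpq
      · rfl

/-- **The trichotomy of non-snc points** (contrapositive of `sncAt_of_family`): at a point `y` with `dim 𝒪_{X,y} = 2`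
which is NOT an snc point of the boundary, either (A) some branch through `y` is singular at `y`; or (B) all branches
through `y` are regular and two of them are tangent (`𝔭_{ζ_k} + 𝔭_{ζ_l} ≠ 𝔪_y`); or (C) all branches through `y` are
regular and pairwise transversal and at least three of them pass through `y`. [cite: Hartshorne1977, Ch. V Thm. 3.9] -/
theorem not_sncAt_trichotomy (hX : Scheme.IsRegular X) (L : List X.IdealSheafData) (ζ : ι → X)
    (hL : ∀ D, D ∈ L ↔ ∃ k, primeDivisorIdeal (ζ k) = D)
    (hcoh : ∀ k, Order.coheight (ζ k) = 1) {y : X} (hdim : ringKrullDim (X.presheaf.stalk y) = 2)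
    (h : ¬ SNCAt L y) :
    (∃ k, ζ k ⤳ y ∧ ¬ IsRegularLocalRing (X.presheaf.stalk y ⧸ stalkIdeal (primeDivisorIdeal (ζ k)) y)) ∨
    ((∀ k, ζ k ⤳ y → IsRegularLocalRing (X.presheaf.stalk y ⧸ stalkIdeal (primeDivisorIdeal (ζ k)) y)) ∧
      ∃ k l, k ≠ l ∧ ζ k ⤳ y ∧ ζ l ⤳ y ∧
        stalkIdeal (primeDivisorIdeal (ζ k)) y ⊔ stalkIdeal (primeDivisorIdeal (ζ l)) y ≠
          maximalIdeal (X.presheaf.stalk y)) ∨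
    ((∀ k, ζ k ⤳ y → IsRegularLocalRing (X.presheaf.stalk y ⧸ stalkIdeal (primeDivisorIdeal (ζ k)) y)) ∧
      (∀ k l, k ≠ l → ζ k ⤳ y → ζ l ⤳ y →
        stalkIdeal (primeDivisorIdeal (ζ k)) y ⊔ stalkIdeal (primeDivisorIdeal (ζ l)) y =
          maximalIdeal (X.presheaf.stalk y)) ∧
      3 ≤ Nat.card {k : ι // ζ k ⤳ y ∧ ζ k ≠ y}) := by
  by_cases hA : ∃ k, ζ k ⤳ y ∧ ¬ IsRegularLocalRing (X.presheaf.stalk y ⧸ stalkIdeal (primeDivisorIdeal (ζ k)) y)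
  · exact Or.inl hA
  push Not at hA
  by_cases hB : ∃ k l, k ≠ l ∧ ζ k ⤳ y ∧ ζ l ⤳ y ∧
      stalkIdeal (primeDivisorIdeal (ζ k)) y ⊔ stalkIdeal (primeDivisorIdeal (ζ l)) y ≠ maximalIdeal (X.presheaf.stalk y)
  · exact Or.inr (Or.inl ⟨hA, hB⟩)
  push Not at hB
  refine Or.inr (Or.inr ⟨hA, hB, ?_⟩)
  by_contra hlt
  exact h (sncAt_of_family hX L ζ hL hcoh hdim hA hB (by omega))

end Family

end CampaignW46

end Summit.ResolutionOfSingularities.ResolutionOfSingularities.Theorems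

end
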